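import Literature.AlgebraicGeometry.HodgeTheory.ComplexTorusIntegralHodgeClassesPontryaginCorrespondencesCommutator
import Literature.AlgebraicGeometry.HodgeTheory.ComplexTorusNeronSeveriPullbackQuadratic
import Literature.AlgebraicGeometry.HodgeTheory.ComplexTorusIntegralHodgeClassesKunnethProjectorsEigenvalues
import Literature.AlgebraicGeometry.HodgeTheory.ComplexTorusIntegralHodgeClassesDividedPowersGeneral
import HarnessLib

/-!
# The Künneth projectors of a principally polarized complex torus, and Künnemann's `[Λ, L] = Σ (g − s) π_s`

Let `X` be a complex torus of dimension `g` and `Θ ∈ NS(X)` a divisor class with `Θ^{[g]} = [pt_X]` in `Hdgᵍ(X, ℤ)` — e.g. `Θ = −θ = c₁(L)`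
for a principal polarization `θ` (a Riemann form of type `(1, …, 1)`, §5). Write `p₁, p₂, μ : X × X → X` for the projections and the
addition, `m(Θ) = μ^*Θ − p₁^*Θ − p₂^*Θ ∈ NS(X × X)` for the Mumford class, and `π_0, …, π_{2g} ∈ Hdgᵍ(X × X, ℤ)` for the integral Künneth
projectors (g29). This file computes ALL the `π_s` as integral polynomials in `p₁^*Θ`, `p₂^*Θ`, `m(Θ)` (divided powers), and deduces
Künnemann's 𝔰𝔩₂-relation for the Lefschetz triple of `Θ` on the integral Hodge classes of `X × X`, unconditionally.

## The argument (formal, no transcendental input beyond the files imported)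

* §1 `sum_pow_smul_kunnethProjector_eq_pullbackHom_pointIntegralHodgeClass`: Lange's (6.18) `ᵗ[Γ_{n_X}] = Σ_s nˢ π_s` (g29-#6) and the
  graph class as a pull-back give `Σ_{s=0}^{2g} nˢ π_s = (pr₁ − n pr₂)^*[pt_X]` for every `n ∈ ℤ`; with `[pt_X] = Θ^{[g]}`, functoriality
  `f^*(Θ^{[g]}) = (f^*Θ)^{[g]}` and the theorem of the cube `(pr₁ − n pr₂)^*Θ = p₁^*Θ + n² p₂^*Θ − n m(Θ)` (g34-#5) this is
  `(p₁^*Θ + n² p₂^*Θ − n m(Θ))^{[g]}` (`sum_pow_smul_kunnethProjector_eq_nsDivPower`), which the divided-power binomial theorem expands as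
  `Σ_{i ≤ g} Σ_{k ≤ i} (n²)^{i−k} (−n)^k p₁^*Θ^{[g−i]} · p₂^*Θ^{[i−k]} · m(Θ)^{[k]}` (`sum_pow_smul_kunnethProjector_eq_sum_sum`).
* §2 `kunnethProjector_eq_sum_nsDivPower`: comparing coefficients of `nˢ` over all `n ∈ ℕ` (Vandermonde, g31-#9):
  `π_s = Σ_{k ≤ i ≤ g, 2i − k = s} (−1)^k p₁^*Θ^{[g−i]} · p₂^*Θ^{[i−k]} · m(Θ)^{[k]}` for every `s ≤ 2g` — an integral refinement of
  `π_i = (log Δ)^{⋆(2g−i)}/(2g−i)!` [Lange2023AbelianVarietiesComplex, Thm. 6.3.12].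
* §3 `mumfordClass_cup_pullbackHom_sndHom_nsDivPower`: the coefficient of `n^{2g−1}` is the single pair `(i, k) = (g, 1)`:
  `m(Θ) · p₂^*Θ^{[g−1]} = −π_{2g−1}` — KÜNNEMANN'S THEOREM 2.3 as used in [Moonen2011ChowMotiveAbelianSchemes, §5, p. 18]
  ("`pr₂^*(λ(β)) · (id × β^{-1})^*(ℓ) = −log[Γ_id]`"); `mumfordClass_cup_pullbackHom_fstHom_nsDivPower` is the mirror `s = 1`.
* §4 `integralHodgeClassesCorrComp_pontryaginCorrespondence_nsDivPower_pushforward_diagHom_sub_eq_sum`: g34-#4 §4 proved Künnemann's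
  `Π_γ ∘ Δ_*(θ) − Δ_*(θ) ∘ Π_γ = Σ_s (g − s) • π_s` GRANTED Thm. 2.3 and `θ · γ = g [pt_X]`; §3 and the divided-power law
  `Θ^{[g−1]} · Θ^{[1]} = g Θ^{[g]}` discharge both for `θ = [Θ]`, `γ = Θ^{[g−1]}`: `[Λ, L] = Σ_{s=0}^{2g} (g − s) π_s = H` [Kü2, Thm. 3.3] holds on
  `Hdg•(X × X, ℤ)` for every `Θ` with `Θ^{[g]} = [pt_X]` (g34-#3 did `g = 1` by hand).
* §5: the same for a principal polarization `θ` in the tree's vocabulary (`IsRiemannForm`, `IsPolarizationType θ (1, …, 1)`), `Θ = −θ`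
  (`nsDivPower_neg_top_eq_pointIntegralHodgeClass_of_principal`: `(−θ)^{[g]} = [pt_X]` from g31's `θ^{[g]} = (−1)^g [pt_X]`).

Theorems only; no new definitions, no named facts.

## References

* [Lange2023AbelianVarietiesComplex] H. Lange, *Abelian Varieties over the Complex Numbers*, Springer 2023 — §6.3.4 (6.16)–(6.18), Prop. 6.3.11,
  Thm. 6.3.12, Cor. 6.3.14 (p0318–p0320); §2.5.3 Cor. 2.5.17, §4.2 Thm. 4.2.2.
* [LangeBirkenhake1992] H. Lange, Ch. Birkenhake, *Complex Abelian Varieties*, Springer 1992 — §1.3 Exercise (12) (theorem of the cube for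
  `(f + g)^*`, p0042 L10–L16), Ch. 2 Exercise (10) (the Mumford bundle, p0051 L8–L14).
* [Moonen2011ChowMotiveAbelianSchemes] B. Moonen, *On the Chow motive of an abelian scheme with non-trivial endomorphisms*, arXiv:1110.4264 —
  §5 (Künnemann's Lefschetz triple, [Kü2] Thm. 2.3 and Thm. 3.3; p0015 L2–L5, p0017 L44 – p0018 L25).
* [Brown1982CohomologyGroups] K. S. Brown, *Cohomology of Groups*, Springer GTM 87, 1982 — Ch. V §6 (divided powers, p0131–p0132).
* [Fulton1998] W. Fulton, *Intersection Theory*, 2nd ed., Springer 1998 — §16.1 (correspondences and the factor-reversing `τ`, p0294–p0296), Example 1.7.4 (p0031).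
-/

noncomputable section

open CategoryTheory Function

namespace Literature.AlgebraicGeometry.HodgeTheory

open Literature.AlgebraicGeometry.Motives Literature.AlgebraicGeometry.Motives.HodgeStructure
open Literature.Geometry.Kaehler Literature.Geometry.Kaehler.ComplexTorus

namespace ComplexTorusCat

section Generating

variable (X : ComplexTorusCat) {gX gXX : ℕ} (eX : Fin (2 * gX) ≃ X.toIsog.ι) (eXX : Fin (2 * gXX) ≃ (prodObj X X).toIsog.ι)
  (hX0 : 2 * gX + 2 * 0 = 2 * gX) (hgX : gX + gX = 2 * gX) (hcX : 2 * gX + 2 * gX = 2 * gXX) (hgXX : gXX + gXX = 2 * gXX)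
  (Θ : neronSeveriGroup X.toIsog.Φ)

/-- **`Σ_{s=0}^{2g} nˢ π_s = (pr₁ − n pr₂)^*[pt_X]`** for every `n ∈ ℤ`: Lange's (6.18) `ᵗ[Γ_{n_X}] = Σ_s nˢ π_s` (g29-#6), the graph class as a pull-back
`[Γ_{n_X}] = (pr₂ − n pr₁)^*[pt_X]` (g28), and `ᵗ = τ_* = τ^*` with `τ ≫ pr₂ = pr₁`, `τ ≫ pr₁ = pr₂`.
[cite: Lange2023AbelianVarietiesComplex, §6.3.4 (6.18) (p0318 L10–L15)] [cite: Fulton1998, §16.1 (p0294 L9–L11: `τ` reverses the factors) and Example 1.7.4 (p0031 L17–L21)] -/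
theorem sum_pow_smul_kunnethProjector_eq_pullbackHom_pointIntegralHodgeClass (n : ℤ) :
    ∑ s ∈ Finset.range (2 * gX + 1), (n ^ s) • kunnethProjector X eX eXX hX0 hgX hcX hgXX s =
      integralHodgeClassesPullbackHom (fstHom X X - sndHom X X ≫ intMul X n) gX (pointIntegralHodgeClass X eX) := by
  haveI : IsIso (swapHom X X) := ⟨⟨swapHom X X, swapHom_swapHom X X, swapHom_swapHom X X⟩⟩
  rw [← integralHodgeClassesPushforward_swapHom_graphClass_intMul_eq_sum X eX eXX hX0 hgX hcX hgXX n,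
    integralHodgeClassesPushforward_graphHom_unitIntegralHodgeClass (intMul X n) eX eX eXX hX0 hgX hcX hgXX,
    integralHodgeClassesPushforward_of_isIso (swapHom X X) eXX eXX hcX hgXX, IsIso.inv_eq_of_hom_inv_id (swapHom_swapHom X X),
    ← integralHodgeClassesPullbackHom_comp, Preadditive.comp_sub, ← Category.assoc, swapHom_sndHom, swapHom_fstHom]

/-- **`Σ_{s=0}^{2g} nˢ π_s = (p₁^*Θ + n² p₂^*Θ − n m(Θ))^{[g]}`** for a divisor class `Θ ∈ NS(X)` with `Θ^{[g]} = [pt_X]` (a principal polarization class) and every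
`n ∈ ℤ`: `[pt_X] = Θ^{[g]}`, `f^*(Θ^{[g]}) = (f^*Θ)^{[g]}`, and the theorem of the cube `(pr₁ − n pr₂)^*Θ = p₁^*Θ + n² p₂^*Θ − n · m(Θ)` (g34-#5), `m(Θ) = μ^*Θ − p₁^*Θ −
p₂^*Θ` the Mumford class. [cite: Lange2023AbelianVarietiesComplex, §6.3.4 (6.18) (p0318 L10–L15)] [cite: LangeBirkenhake1992, §1.3 Exercise (12) (p0042 L10–L16) and Ch. 2 Exercise
(10) (p0051 L8–L14)] -/
theorem sum_pow_smul_kunnethProjector_eq_nsDivPower (hΘ : nsDivPower X Θ gX = pointIntegralHodgeClass X eX) (n : ℤ) :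
    ∑ s ∈ Finset.range (2 * gX + 1), (n ^ s) • kunnethProjector X eX eXX hX0 hgX hcX hgXX s =
      nsDivPower (prodObj X X)
        (nsPullbackHom (fstHom X X) Θ + (n ^ 2) • nsPullbackHom (sndHom X X) Θ -
          n • (nsPullbackHom (addHom X) Θ - nsPullbackHom (fstHom X X) Θ - nsPullbackHom (sndHom X X) Θ)) gX := by
  rw [sum_pow_smul_kunnethProjector_eq_pullbackHom_pointIntegralHodgeClass, ← hΘ, integralHodgeClassesPullbackHom_nsDivPower,
    nsPullbackHom_fstHom_sub_sndHom_intMul]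

/-- **THE GENERATING IDENTITY `Σ_{s=0}^{2g} nˢ π_s = Σ_{i=0}^{g} p₁^*Θ^{[g−i]} · Σ_{k=0}^{i} (n²)^{i−k} (−n)^k p₂^*Θ^{[i−k]} · m(Θ)^{[k]}`** for `Θ ∈ NS(X)` with
`Θ^{[g]} = [pt_X]` and all `n ∈ ℤ` — the trinomial divided-power expansion of `(p₁^*Θ + n² p₂^*Θ − n m(Θ))^{[g]}` (`(x + y)^{[p]} = Σ x^{[p−i]} y^{[i]}`, `(c x)^{[i]}
= cⁱ x^{[i]}`, `f^*(Θ^{[j]}) = (f^*Θ)^{[j]}`). [cite: Lange2023AbelianVarietiesComplex, §6.3.4 (6.18) (p0318 L10–L15)] [cite: Brown1982CohomologyGroups, Ch. V §6 (p0131 L4–L6)]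
[cite: LangeBirkenhake1992, §1.3 Exercise (12) (p0042 L10–L16)] -/
theorem sum_pow_smul_kunnethProjector_eq_sum_sum (hΘ : nsDivPower X Θ gX = pointIntegralHodgeClass X eX) (n : ℤ) :
    ∑ s ∈ Finset.range (2 * gX + 1), (n ^ s) • kunnethProjector X eX eXX hX0 hgX hcX hgXX s =
      ∑ i : Fin (gX + 1), integralHodgeClassesCup (prodObj X X).toIsog.Φ (Nat.sub_add_cancel (Nat.lt_succ_iff.1 i.2))
        (nsDivPower (prodObj X X) (nsPullbackHom (fstHom X X) Θ) (gX - i))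
        (∑ k : Fin (i + 1), ((n ^ 2) ^ ((i : ℕ) - k) * (-n) ^ (k : ℕ)) •
          integralHodgeClassesCup (prodObj X X).toIsog.Φ (Nat.sub_add_cancel (Nat.lt_succ_iff.1 k.2))
            (nsDivPower (prodObj X X) (nsPullbackHom (sndHom X X) Θ) (i - k))
            (nsDivPower (prodObj X X) (nsPullbackHom (addHom X) Θ - nsPullbackHom (fstHom X X) Θ - nsPullbackHom (sndHom X X) Θ) k)) := by
  rw [sum_pow_smul_kunnethProjector_eq_nsDivPower X eX eXX hX0 hgX hcX hgXX Θ hΘ n, sub_eq_add_neg, ← neg_zsmul, add_assoc, nsDivPower_add]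
  refine Finset.sum_congr rfl fun i _ ↦ ?_
  rw [nsDivPower_add]
  congr 1
  refine Finset.sum_congr rfl fun k _ ↦ ?_
  rw [nsDivPower_zsmul, nsDivPower_zsmul, integralHodgeClassesCup_zsmul_left, integralHodgeClassesCup_zsmul_right, smul_smul]

end Generating

/-! ## §2 Comparing coefficients: the Künneth projectors of a principally polarized torus -/

section Formula

variable (X : ComplexTorusCat) {gX gXX : ℕ} (eX : Fin (2 * gX) ≃ X.toIsog.ι) (eXX : Fin (2 * gXX) ≃ (prodObj X X).toIsog.ι)
  (hX0 : 2 * gX + 2 * 0 = 2 * gX) (hgX : gX + gX = 2 * gX) (hcX : 2 * gX + 2 * gX = 2 * gXX) (hgXX : gXX + gXX = 2 * gXX)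
  (Θ : neronSeveriGroup X.toIsog.Φ)

/-- **THE KÜNNETH PROJECTORS OF A PRINCIPALLY POLARIZED COMPLEX TORUS, EXPLICITLY: `π_s = Σ_{k ≤ i ≤ g, 2i − k = s} (−1)^k p₁^*Θ^{[g−i]} · p₂^*Θ^{[i−k]} · m(Θ)^{[k]}`** in
`Hdgᵍ(X × X, ℤ)` for every `s ≤ 2g`, every complex torus `X` of dimension `g` and every `Θ ∈ NS(X)` with `Θ^{[g]} = [pt_X]`, where `m(Θ) = μ^*Θ − p₁^*Θ − p₂^*Θ` is the
Mumford class (sum over the pairs `(i, k)`, `0 ≤ k ≤ i ≤ g`, as a `Σ`-type): comparing coefficients of `nˢ` (`n ∈ ℕ`, Vandermonde — g31-#9's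
`integralHodgeClasses_coeff_eq_zero_of_forall_nat`) in §1's generating identity. The cases: `π_0 = p₁^*Θ^{[g]} = [(0) × X]`, `π_{2g} = p₂^*Θ^{[g]} = [X × (0)]` (Cor. 6.3.14),
`π_1 = −p₁^*Θ^{[g−1]} · m(Θ)`, `π_{2g−1} = −p₂^*Θ^{[g−1]} · m(Θ)` (Künnemann's Thm. 2.3, §3), `π_2 = p₁^*Θ^{[g−1]} · p₂^*Θ + p₁^*Θ^{[g−2]} · m(Θ)^{[2]}`, … — integral
refinements of Lange's `π_i = (log Δ)^{⋆(2g−i)}/(2g−i)!`. [cite: Lange2023AbelianVarietiesComplex, §6.3.4 (6.18) (p0318 L10–L15), Prop. 6.3.11 (proof, p0319 L26) and Thm. 6.3.12 (p0320 L1–L7)]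
[cite: Moonen2011ChowMotiveAbelianSchemes, §5 proof (p0018 L13–L14)] [cite: LangeBirkenhake1992, §1.3 Exercise (12) (p0042 L10–L16) and Ch. 2 Exercise (10) (p0051 L8–L14)] -/
theorem kunnethProjector_eq_sum_nsDivPower (hΘ : nsDivPower X Θ gX = pointIntegralHodgeClass X eX) {s : ℕ} (hs : s ≤ 2 * gX) :
    kunnethProjector X eX eXX hX0 hgX hcX hgXX s =
      ∑ x ∈ (Finset.univ : Finset (Σ i : Fin (gX + 1), Fin ((i : ℕ) + 1))).filter (fun x ↦ 2 * (x.1 : ℕ) - (x.2 : ℕ) = s),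
        ((-1 : ℤ) ^ (x.2 : ℕ)) •
          integralHodgeClassesCup (prodObj X X).toIsog.Φ (Nat.sub_add_cancel (Nat.lt_succ_iff.1 x.1.2))
            (nsDivPower (prodObj X X) (nsPullbackHom (fstHom X X) Θ) (gX - x.1))
            (integralHodgeClassesCup (prodObj X X).toIsog.Φ (Nat.sub_add_cancel (Nat.lt_succ_iff.1 x.2.2))
              (nsDivPower (prodObj X X) (nsPullbackHom (sndHom X X) Θ) (x.1 - x.2))
              (nsDivPower (prodObj X X) (nsPullbackHom (addHom X) Θ - nsPullbackHom (fstHom X X) Θ - nsPullbackHom (sndHom X X) Θ) x.2)) := by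
  refine sub_eq_zero.1 (integralHodgeClasses_coeff_eq_zero_of_forall_nat
    (fun s ↦ kunnethProjector X eX eXX hX0 hgX hcX hgXX s -
      ∑ x ∈ (Finset.univ : Finset (Σ i : Fin (gX + 1), Fin ((i : ℕ) + 1))).filter (fun x ↦ 2 * (x.1 : ℕ) - (x.2 : ℕ) = s),
        ((-1 : ℤ) ^ (x.2 : ℕ)) •
          integralHodgeClassesCup (prodObj X X).toIsog.Φ (Nat.sub_add_cancel (Nat.lt_succ_iff.1 x.1.2))
            (nsDivPower (prodObj X X) (nsPullbackHom (fstHom X X) Θ) (gX - x.1))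
            (integralHodgeClassesCup (prodObj X X).toIsog.Φ (Nat.sub_add_cancel (Nat.lt_succ_iff.1 x.2.2))
              (nsDivPower (prodObj X X) (nsPullbackHom (sndHom X X) Θ) (x.1 - x.2))
              (nsDivPower (prodObj X X) (nsPullbackHom (addHom X) Θ - nsPullbackHom (fstHom X X) Θ - nsPullbackHom (sndHom X X) Θ) x.2)))
    (fun n ↦ ?_) hs)
  simp only [smul_sub, Finset.sum_sub_distrib, sub_eq_zero]
  rw [sum_pow_smul_kunnethProjector_eq_sum_sum X eX eXX hX0 hgX hcX hgXX Θ hΘ (n : ℤ)]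
  simp_rw [map_sum, integralHodgeClassesCup_zsmul_right, Finset.smul_sum]
  rw [Finset.sum_sigma' Finset.univ (fun i : Fin (gX + 1) ↦ (Finset.univ : Finset (Fin ((i : ℕ) + 1)))), Finset.univ_sigma_univ,
    ← Finset.sum_fiberwise_of_maps_to (s := Finset.univ) (t := Finset.range (2 * gX + 1))
      (g := fun x : (Σ i : Fin (gX + 1), Fin ((i : ℕ) + 1)) ↦ 2 * (x.1 : ℕ) - (x.2 : ℕ)) (fun x _ ↦ Finset.mem_range.2 (by have := x.1.2; omega))]
  refine Finset.sum_congr rfl fun s _ ↦ Finset.sum_congr rfl fun x hx ↦ ?_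
  have hk : (x.2 : ℕ) ≤ x.1 := Nat.lt_succ_iff.1 x.2.2
  rw [← (Finset.mem_filter.1 hx).2, smul_smul]
  congr 1
  rw [show 2 * (x.1 : ℕ) - x.2 = 2 * ((x.1 : ℕ) - x.2) + x.2 by omega, pow_add, pow_mul, neg_pow]
  ring

end Formula

/-! ## §3 Künnemann's Theorem 2.3: `p₂^*Θ^{[g−1]} · m(Θ) = −π_{2g−1}` -/

section TopCoefficient

variable (X : ComplexTorusCat) {gX gXX : ℕ} (eX : Fin (2 * gX) ≃ X.toIsog.ι) (eXX : Fin (2 * gXX) ≃ (prodObj X X).toIsog.ι)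
  (hX0 : 2 * gX + 2 * 0 = 2 * gX) (hgX : gX + gX = 2 * gX) (hcX : 2 * gX + 2 * gX = 2 * gXX) (hgXX : gXX + gXX = 2 * gXX)
  (Θ : neronSeveriGroup X.toIsog.Φ)

/-- `α^{[i]} · y = y` when `i = 0` (`α^{[0]} = 1`), for an index written as `i`. [cite: Brown1982CohomologyGroups, Ch. V §6 (p0131 L4)] -/
private theorem cup_nsDivPower_of_eq_zero₆ {Y : ComplexTorusCat} (α : neronSeveriGroup Y.toIsog.Φ) {i r : ℕ} (h : i + r = r)
    (y : integralHodgeClasses Y.toIsog.Φ r) (hi : i = 0) : integralHodgeClassesCup Y.toIsog.Φ h (nsDivPower Y α i) y = y := by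
  subst hi
  rw [nsDivPower_zero_eq_unitIntegralHodgeClass, integralHodgeClassesCup_unitIntegralHodgeClass_left]

/-- `β^{[j]} · y = y · β^{[d]}` when `j = d`, for an index written as `j` (even degrees commute). [cite: Brown1982CohomologyGroups, Ch. V §6 (p0131 L4)] -/
private theorem cup_nsDivPower_of_eq₆ {Y : ComplexTorusCat} (β : neronSeveriGroup Y.toIsog.Φ) {j d r : ℕ} (h : j + 1 = r) (hcd : 1 + d = r)
    (y : integralHodgeClasses Y.toIsog.Φ 1) (hj : j = d) :
    integralHodgeClassesCup Y.toIsog.Φ h (nsDivPower Y β j) y = integralHodgeClassesCup Y.toIsog.Φ hcd y (nsDivPower Y β d) := by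
  subst hj
  rw [integralHodgeClassesCup_comm _ hcd h]

/-- A sum over a filter of `univ` singling out one element. [folklore] -/
private theorem sum_filter_eq_single₆ {ι M : Type*} [Fintype ι] [AddCommMonoid M] (p : ι → Prop) [DecidablePred p] (f : ι → M) (a : ι) (ha : p a)
    (huniq : ∀ b, p b → b = a) : ∑ x ∈ Finset.univ.filter p, f x = f a :=
  Finset.sum_eq_single_of_mem a (Finset.mem_filter.2 ⟨Finset.mem_univ _, ha⟩) fun b hb hne ↦ absurd (huniq b (Finset.mem_filter.1 hb).2) hne

/-- **KÜNNEMANN'S THEOREM 2.3 ON THE INTEGRAL CARRIERS: `m(Θ) · p₂^*Θ^{[g−1]} = −π_{2g−1}`** — for every complex torus `X` of dimension `g = d + 1` and every `Θ ∈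
NS(X)` with `Θ^{[g]} = [pt_X]` (a principal polarization class; `θ = [Θ] ∈ Hdg¹(X, ℤ)`), the product of the Mumford class `m(Θ) = μ^*θ − p₁^*θ − p₂^*θ` with
`p₂^*Θ^{[g−1]}` is MINUS the Künneth projector `π_{2g−1} = log[Δ]`: Moonen's "`pr₂^*(λ(β)) · (id × β^{-1})^*(ℓ) = −(βγ × id)^* log[Γ_id]`, by [(KunLef)], Thm. 2.3"
(`λ = Θ^{[g−1]}`, `(id × γ)^*ℓ = Σ^*ℓ(γ) − pr₁^*ℓ(γ) − pr₂^*ℓ(γ)`), here the coefficient of `n^{2g−1}` in §1: only `(i, k) = (g, 1)` has `2i − k = 2g − 1`. This is the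
hypothesis `hm` of g34-#4 §4. [cite: Moonen2011ChowMotiveAbelianSchemes, §5 proof (p0018 L13–L20)] [cite: Lange2023AbelianVarietiesComplex, §6.3.4 Thm. 6.3.12 (p0320 L1–L7: "`log Δ = π_{2g−1}`")]
[cite: LangeBirkenhake1992, Ch. 2 Exercise (10) (p0051 L8–L14)] -/
theorem mumfordClass_cup_pullbackHom_sndHom_nsDivPower (hΘ : nsDivPower X Θ gX = pointIntegralHodgeClass X eX) {d : ℕ} (hd : d + 1 = gX) (hcd : 1 + d = gX) :
    integralHodgeClassesCup (prodObj X X).toIsog.Φ hcd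
        (integralHodgeClassesPullbackHom (addHom X) 1 (neronSeveriGroupEquiv X.toIsog.Φ Θ)
          - integralHodgeClassesPullbackHom (fstHom X X) 1 (neronSeveriGroupEquiv X.toIsog.Φ Θ)
          - integralHodgeClassesPullbackHom (sndHom X X) 1 (neronSeveriGroupEquiv X.toIsog.Φ Θ))
        (integralHodgeClassesPullbackHom (sndHom X X) d (nsDivPower X Θ d)) =
      -kunnethProjector X eX eXX hX0 hgX hcX hgXX (2 * gX - 1) := by
  subst hd
  rw [kunnethProjector_eq_sum_nsDivPower X eX eXX hX0 hgX hcX hgXX Θ hΘ (s := 2 * (d + 1) - 1) (by omega),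
    sum_filter_eq_single₆ (fun x : (Σ i : Fin (d + 1 + 1), Fin ((i : ℕ) + 1)) ↦ 2 * (x.1 : ℕ) - (x.2 : ℕ) = 2 * (d + 1) - 1) _
      ⟨⟨d + 1, by omega⟩, ⟨1, Nat.succ_lt_succ (Nat.succ_pos d)⟩⟩ rfl (by
        rintro ⟨⟨i, hi⟩, ⟨k, hk⟩⟩ h2
        dsimp only at h2 hk
        obtain rfl : i = d + 1 := by omega
        obtain rfl : k = 1 := by omega
        rfl)]
  simp only [Fin.val_mk]
  rw [cup_nsDivPower_of_eq_zero₆ (nsPullbackHom (fstHom X X) Θ) _ _ (Nat.sub_self _), nsDivPower_one,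
    cup_nsDivPower_of_eq₆ (nsPullbackHom (sndHom X X) Θ) _ hcd _ (Nat.add_sub_cancel d 1), pow_one, neg_one_zsmul, neg_neg, ← integralHodgeClassesPullbackHom_nsDivPower, map_sub (neronSeveriGroupEquiv (prodObj X X).toIsog.Φ),
    map_sub (neronSeveriGroupEquiv (prodObj X X).toIsog.Φ), neronSeveriGroupEquiv_nsPullbackHom, neronSeveriGroupEquiv_nsPullbackHom,
    neronSeveriGroupEquiv_nsPullbackHom]

/-- **The mirror case `s = 1`: `m(Θ) · p₁^*Θ^{[g−1]} = −π_1`** — `2i − k = 1` with `k ≤ i` forces `(i, k) = (1, 1)`, so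
`π_1 = −p₁^*Θ^{[g−1]} · p₂^*Θ^{[0]} · m(Θ) = −p₁^*Θ^{[g−1]} · m(Θ)`: the transpose of Thm. 2.3 (`ᵗπ_{2g−1} = π_1`, `ᵗm(Θ) = m(Θ)`).
[cite: Moonen2011ChowMotiveAbelianSchemes, §5 proof (p0018 L13–L20)] [cite: Lange2023AbelianVarietiesComplex, §6.3.4 (6.16) and Thm. 6.3.12 (p0318 L1–L5, p0320 L1–L7)] -/
theorem mumfordClass_cup_pullbackHom_fstHom_nsDivPower (hΘ : nsDivPower X Θ gX = pointIntegralHodgeClass X eX) {d : ℕ} (hd : d + 1 = gX) (hcd : 1 + d = gX) :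
    integralHodgeClassesCup (prodObj X X).toIsog.Φ hcd
        (integralHodgeClassesPullbackHom (addHom X) 1 (neronSeveriGroupEquiv X.toIsog.Φ Θ)
          - integralHodgeClassesPullbackHom (fstHom X X) 1 (neronSeveriGroupEquiv X.toIsog.Φ Θ)
          - integralHodgeClassesPullbackHom (sndHom X X) 1 (neronSeveriGroupEquiv X.toIsog.Φ Θ))
        (integralHodgeClassesPullbackHom (fstHom X X) d (nsDivPower X Θ d)) =
      -kunnethProjector X eX eXX hX0 hgX hcX hgXX 1 := by
  subst hd
  rw [kunnethProjector_eq_sum_nsDivPower X eX eXX hX0 hgX hcX hgXX Θ hΘ (s := 1) (by omega),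
    sum_filter_eq_single₆ (fun x : (Σ i : Fin (d + 1 + 1), Fin ((i : ℕ) + 1)) ↦ 2 * (x.1 : ℕ) - (x.2 : ℕ) = 1) _
      ⟨⟨1, by omega⟩, ⟨1, Nat.succ_lt_succ Nat.one_pos⟩⟩ rfl (by
        rintro ⟨⟨i, hi⟩, ⟨k, hk⟩⟩ h2
        dsimp only at h2 hk
        obtain rfl : i = 1 := by omega
        obtain rfl : k = 1 := by omega
        rfl)]
  simp only [Fin.val_mk]
  rw [cup_nsDivPower_of_eq_zero₆ (nsPullbackHom (sndHom X X) Θ) _ _ (Nat.sub_self 1), nsDivPower_one,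
    cup_nsDivPower_of_eq₆ (nsPullbackHom (fstHom X X) Θ) _ hcd _ (Nat.add_sub_cancel d 1), pow_one, neg_one_zsmul, neg_neg,
    ← integralHodgeClassesPullbackHom_nsDivPower, map_sub (neronSeveriGroupEquiv (prodObj X X).toIsog.Φ), map_sub (neronSeveriGroupEquiv (prodObj X X).toIsog.Φ),
    neronSeveriGroupEquiv_nsPullbackHom, neronSeveriGroupEquiv_nsPullbackHom, neronSeveriGroupEquiv_nsPullbackHom]

end TopCoefficient

/-! ## §4 Künnemann's `[Λ, L] = Σ_s (g − s) π_s` for a principal polarization class, unconditionally -/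

section Kunnemann

variable (X : ComplexTorusCat) {gX gXX gT : ℕ} (eX : Fin (2 * gX) ≃ X.toIsog.ι) (eXX : Fin (2 * gXX) ≃ (prodObj X X).toIsog.ι)
  (eT : Fin (2 * gT) ≃ (prodObj X (prodObj X X)).toIsog.ι) (hX0 : 2 * gX + 2 * 0 = 2 * gX) (hgX : gX + gX = 2 * gX) (hcX : 2 * gX + 2 * gX = 2 * gXX)
  (hgXX : gXX + gXX = 2 * gXX) (hgT : gT + gT = 2 * gT) (hN : 2 * gX + 2 * gXX = 2 * gT) (hgg₀ : gX + gXX = gT) (hXX0 : 2 * gXX + 2 * 0 = 2 * gXX)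
  (hlr₀ : 2 * gXX + 2 * gX = 2 * gT) (hXXg : gX + gX = gXX) {C : ℕ} (hCC : gX + gX = C) (hC : 2 * gX + 2 * C = 2 * gT)
  {c₁ d K₁ K₂ l l₃ l₃' L Lm : ℕ} (hl : l + 2 * 1 = 2 * gX) (hl' : l + 2 * c₁ = 2 * gXX) (hq : L + 2 * d = 2 * gXX) (hK₁ : c₁ + d = K₁)
  (h3₁ : l₃ + 2 * K₁ = 2 * gT) (h3₁' : l₃ + 2 * gX = 2 * gXX) (hcd : 1 + d = gX) (hdc : d + 1 = gX) (hK₂ : d + c₁ = K₂) (h3₂ : l₃' + 2 * K₂ = 2 * gT)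
  (h3₂' : l₃' + 2 * gX = 2 * gXX) (hqm : Lm + 2 * gX = 2 * gXX) (Θ : neronSeveriGroup X.toIsog.Φ)

include hN hgg₀ hXX0 hlr₀ hXXg hCC hC hcd hdc hqm in
/-- **KÜNNEMANN'S 𝔰𝔩₂-RELATION `[Λ, L] = Σ_{s=0}^{2g} (g − s) π_s` ON THE INTEGRAL HODGE CLASSES OF `X × X`, FOR EVERY PRINCIPAL POLARIZATION CLASS.** Let `X` be a
complex torus of dimension `g = d + 1` and `Θ ∈ NS(X)` with `Θ^{[g]} = [pt_X]`; put `θ = [Θ] ∈ Hdg¹(X, ℤ)`, `L = Δ_*(θ)` (the Lefschetz correspondence) and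
`Λ = Π_{Θ^{[g−1]}} = (s_X)_*(p₂^*Θ^{[g−1]})` (the Pontryagin correspondence of `λ = Θ^{[g−1]}`). Then, as correspondences composed on `X × X × X`,
`Λ ∘ L − L ∘ Λ = Σ_{s=0}^{2g} (g − s) • π_s` — Künnemann's `[Λ, L] = H = Σ (g − i) π_i` [Kü2, Thm. 3.3], integrally and for complex tori: g34-#4 §4 (the relation
granted Thm. 2.3) fed with §3 (Thm. 2.3: `m(Θ) · p₂^*Θ^{[g−1]} = −π_{2g−1}`) and the divided-power law `θ · Θ^{[g−1]} = Θ^{[g−1]} · Θ^{[1]} = C(g, g−1) Θ^{[g]} = g [pt_X]`.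
(g34-#3 is the case `g = 1`; the frames `eT`, … and the bookkeeping hypotheses are those of g34-#4.) [cite: Moonen2011ChowMotiveAbelianSchemes, §5 (p0015 L2–L5: "[Kü2], Thm. 3.3")
and §5 proof (p0017 L44 – p0018 L25)] [cite: Lange2023AbelianVarietiesComplex, §6.3.4 Thm. 6.3.12 (p0320 L1–L7)] [cite: Brown1982CohomologyGroups, Ch. V §6 (p0131 L5)] -/
theorem integralHodgeClassesCorrComp_pontryaginCorrespondence_nsDivPower_pushforward_diagHom_sub_eq_sum
    (hΘ : nsDivPower X Θ gX = pointIntegralHodgeClass X eX) :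
    integralHodgeClassesPushforward K₁ gX (liftHom (fstHom X (prodObj X X)) (sndHom X (prodObj X X) ≫ sndHom X X)) eT eXX h3₁ hgT h3₁' hgXX
      (integralHodgeClassesCup (prodObj X (prodObj X X)).toIsog.Φ hK₁
        (integralHodgeClassesPullbackHom (liftHom (fstHom X (prodObj X X)) (sndHom X (prodObj X X) ≫ fstHom X X)) c₁
          (integralHodgeClassesPushforward 1 c₁ (diagHom X) eX eXX hl hgX hl' hgXX (neronSeveriGroupEquiv X.toIsog.Φ Θ)))
        (integralHodgeClassesPullbackHom (sndHom X (prodObj X X)) d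
          (integralHodgeClassesPushforward d d (liftHom (fstHom X X) (fstHom X X + sndHom X X)) eXX eXX hq hgXX hq hgXX
            (integralHodgeClassesPullbackHom (sndHom X X) d (nsDivPower X Θ d))))) -
      integralHodgeClassesPushforward K₂ gX (liftHom (fstHom X (prodObj X X)) (sndHom X (prodObj X X) ≫ sndHom X X)) eT eXX h3₂ hgT h3₂' hgXX
        (integralHodgeClassesCup (prodObj X (prodObj X X)).toIsog.Φ hK₂
          (integralHodgeClassesPullbackHom (liftHom (fstHom X (prodObj X X)) (sndHom X (prodObj X X) ≫ fstHom X X)) d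
            (integralHodgeClassesPushforward d d (liftHom (fstHom X X) (fstHom X X + sndHom X X)) eXX eXX hq hgXX hq hgXX
              (integralHodgeClassesPullbackHom (sndHom X X) d (nsDivPower X Θ d))))
          (integralHodgeClassesPullbackHom (sndHom X (prodObj X X)) c₁
            (integralHodgeClassesPushforward 1 c₁ (diagHom X) eX eXX hl hgX hl' hgXX (neronSeveriGroupEquiv X.toIsog.Φ Θ)))) =
      ∑ s ∈ Finset.range (2 * gX + 1), ((gX : ℤ) - s) • kunnethProjector X eX eXX hX0 hgX hcX hgXX s :=
  integralHodgeClassesCorrComp_pushforward_diagHom_pontryaginCorrespondence_sub_eq_sum_of_mumford X eX eXX eT hX0 hgX hcX hgXX hgT hN hgg₀ hXX0 hlr₀ hXXg hCC hC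
    hl hl' hq hK₁ h3₁ h3₁' hcd hdc hK₂ h3₂ h3₂' hqm (by omega) _ _ (by
      rw [integralHodgeClassesCup_comm X.toIsog.Φ hdc hcd, ← nsDivPower_one]
      subst hdc
      rw [integralHodgeClassesCup_nsDivPower, hΘ, Nat.choose_succ_self_right])
    (mumfordClass_cup_pullbackHom_sndHom_nsDivPower X eX eXX hX0 hgX hcX hgXX Θ hΘ hdc hcd)

end Kunnemann

/-! ## §5 Principal polarizations in the tree's vocabulary (`IsRiemannForm`, type `(1, …, 1)`): `Θ = −θ = c₁(L)` -/

section Principal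

variable (X : ComplexTorusCat) {gX gXX gT : ℕ} (eX : Fin (2 * gX) ≃ X.toIsog.ι) (eXX : Fin (2 * gXX) ≃ (prodObj X X).toIsog.ι)
  (eT : Fin (2 * gT) ≃ (prodObj X (prodObj X X)).toIsog.ι) (hX0 : 2 * gX + 2 * 0 = 2 * gX) (hgX : gX + gX = 2 * gX) (hcX : 2 * gX + 2 * gX = 2 * gXX)
  (hgXX : gXX + gXX = 2 * gXX) (hgT : gT + gT = 2 * gT) (hN : 2 * gX + 2 * gXX = 2 * gT) (hgg₀ : gX + gXX = gT) (hXX0 : 2 * gXX + 2 * 0 = 2 * gXX)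
  (hlr₀ : 2 * gXX + 2 * gX = 2 * gT) (hXXg : gX + gX = gXX) {C : ℕ} (hCC : gX + gX = C) (hC : 2 * gX + 2 * C = 2 * gT)
  {c₁ d K₁ K₂ l l₃ l₃' L Lm : ℕ} (hl : l + 2 * 1 = 2 * gX) (hl' : l + 2 * c₁ = 2 * gXX) (hq : L + 2 * d = 2 * gXX) (hK₁ : c₁ + d = K₁)
  (h3₁ : l₃ + 2 * K₁ = 2 * gT) (h3₁' : l₃ + 2 * gX = 2 * gXX) (hcd : 1 + d = gX) (hdc : d + 1 = gX) (hK₂ : d + c₁ = K₂) (h3₂ : l₃' + 2 * K₂ = 2 * gT)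
  (h3₂' : l₃' + 2 * gX = 2 * gXX) (hqm : Lm + 2 * gX = 2 * gXX) {θ : neronSeveriGroup X.toIsog.Φ}
  (hθ : IsRiemannForm X.toIsog.Φ (θ : X.toIsog.E [⋀^Fin 2]→L[ℝ] ℝ)) (hd₁ : IsPolarizationType X.toIsog.Φ (θ : X.toIsog.E [⋀^Fin 2]→L[ℝ] ℝ) fun _ : Fin gX ↦ 1)

include hθ hd₁ in
/-- **`(−θ)^{[g]} = [pt_X]` for a principal polarization `θ`** (a Riemann form of type `(1, …, 1)`): `θ^{[g]} = (−1)^g [pt_X]` (g31, the sign because the tree's Riemann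
form is `−c₁(L)`) and `(−θ)^{[g]} = (−1)^g θ^{[g]}` — so `Θ = −θ = c₁(L)` satisfies the hypothesis `Θ^{[g]} = [pt_X]` of §§1–4.
[cite: Lange2023AbelianVarietiesComplex, §2.5.3 Cor. 2.5.17 (a) (p0135) and §4.2 Thm. 4.2.2 (p0203–p0204)] [cite: Brown1982CohomologyGroups, Ch. V §6 (p0131 L6)] -/
theorem nsDivPower_neg_top_eq_pointIntegralHodgeClass_of_principal : nsDivPower X (-θ) gX = pointIntegralHodgeClass X eX := by
  rw [nsDivPower_neg, nsDivPower_top_eq_of_principal X eX hθ hd₁, smul_smul, ← mul_pow, neg_mul_neg, one_mul, one_pow, one_smul]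

include hdc hθ hd₁ in
/-- **KÜNNEMANN'S THEOREM 2.3 FOR A PRINCIPALLY POLARIZED COMPLEX TORUS `(X, θ)`: `m(Θ) · p₂^*Θ^{[g−1]} = −π_{2g−1}`, `Θ = −θ = c₁(L)`** (§3 with `Θ^{[g]} = [pt_X]`
from the type `(1, …, 1)`). [cite: Moonen2011ChowMotiveAbelianSchemes, §5 proof (p0018 L13–L20)] [cite: Lange2023AbelianVarietiesComplex, §6.3.4 Thm. 6.3.12 (p0320 L1–L7) and
§4.2 Thm. 4.2.2 (p0203–p0204)] -/
theorem mumfordClass_cup_pullbackHom_sndHom_nsDivPower_of_principal :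
    integralHodgeClassesCup (prodObj X X).toIsog.Φ hcd
        (integralHodgeClassesPullbackHom (addHom X) 1 (neronSeveriGroupEquiv X.toIsog.Φ (-θ))
          - integralHodgeClassesPullbackHom (fstHom X X) 1 (neronSeveriGroupEquiv X.toIsog.Φ (-θ))
          - integralHodgeClassesPullbackHom (sndHom X X) 1 (neronSeveriGroupEquiv X.toIsog.Φ (-θ)))
        (integralHodgeClassesPullbackHom (sndHom X X) d (nsDivPower X (-θ) d)) =
      -kunnethProjector X eX eXX hX0 hgX hcX hgXX (2 * gX - 1) :=
  mumfordClass_cup_pullbackHom_sndHom_nsDivPower X eX eXX hX0 hgX hcX hgXX (-θ) (nsDivPower_neg_top_eq_pointIntegralHodgeClass_of_principal X eX hθ hd₁) hdc hcd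

include hN hgg₀ hXX0 hlr₀ hXXg hCC hC hcd hdc hqm hθ hd₁ in
/-- **KÜNNEMANN'S `[Λ, L] = Σ_{s=0}^{2g} (g − s) π_s` FOR EVERY PRINCIPALLY POLARIZED COMPLEX TORUS `(X, θ)` OF DIMENSION `g = d + 1`** — in particular for every
principally polarized abelian variety — with `Θ = −θ = c₁(L)`, `L = Δ_*[Θ]`, `Λ = Π_{Θ^{[g−1]}}`: §4 with `Θ^{[g]} = [pt_X]` from the type `(1, …, 1)`. This is the
𝔰𝔩₂-relation `[Λ, L] = H` of the Lefschetz triple attached to `θ` [Kü2, Thm. 3.3], on `Hdg•(X × X, ℤ)` with correspondences composed on `X × X × X`.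
[cite: Moonen2011ChowMotiveAbelianSchemes, §5 (p0015 L2–L5) and §5 proof (p0017 L44 – p0018 L25)] [cite: Lange2023AbelianVarietiesComplex, §6.3.4 Thm. 6.3.12 (p0320 L1–L7) and
§4.2 Thm. 4.2.2 (p0203–p0204)] -/
theorem integralHodgeClassesCorrComp_pontryaginCorrespondence_nsDivPower_pushforward_diagHom_sub_eq_sum_of_principal :
    integralHodgeClassesPushforward K₁ gX (liftHom (fstHom X (prodObj X X)) (sndHom X (prodObj X X) ≫ sndHom X X)) eT eXX h3₁ hgT h3₁' hgXX
      (integralHodgeClassesCup (prodObj X (prodObj X X)).toIsog.Φ hK₁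
        (integralHodgeClassesPullbackHom (liftHom (fstHom X (prodObj X X)) (sndHom X (prodObj X X) ≫ fstHom X X)) c₁
          (integralHodgeClassesPushforward 1 c₁ (diagHom X) eX eXX hl hgX hl' hgXX (neronSeveriGroupEquiv X.toIsog.Φ (-θ))))
        (integralHodgeClassesPullbackHom (sndHom X (prodObj X X)) d
          (integralHodgeClassesPushforward d d (liftHom (fstHom X X) (fstHom X X + sndHom X X)) eXX eXX hq hgXX hq hgXX
            (integralHodgeClassesPullbackHom (sndHom X X) d (nsDivPower X (-θ) d))))) -
      integralHodgeClassesPushforward K₂ gX (liftHom (fstHom X (prodObj X X)) (sndHom X (prodObj X X) ≫ sndHom X X)) eT eXX h3₂ hgT h3₂' hgXX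
        (integralHodgeClassesCup (prodObj X (prodObj X X)).toIsog.Φ hK₂
          (integralHodgeClassesPullbackHom (liftHom (fstHom X (prodObj X X)) (sndHom X (prodObj X X) ≫ fstHom X X)) d
            (integralHodgeClassesPushforward d d (liftHom (fstHom X X) (fstHom X X + sndHom X X)) eXX eXX hq hgXX hq hgXX
              (integralHodgeClassesPullbackHom (sndHom X X) d (nsDivPower X (-θ) d))))
          (integralHodgeClassesPullbackHom (sndHom X (prodObj X X)) c₁
            (integralHodgeClassesPushforward 1 c₁ (diagHom X) eX eXX hl hgX hl' hgXX (neronSeveriGroupEquiv X.toIsog.Φ (-θ))))) =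
      ∑ s ∈ Finset.range (2 * gX + 1), ((gX : ℤ) - s) • kunnethProjector X eX eXX hX0 hgX hcX hgXX s :=
  integralHodgeClassesCorrComp_pontryaginCorrespondence_nsDivPower_pushforward_diagHom_sub_eq_sum X eX eXX eT hX0 hgX hcX hgXX hgT hN hgg₀ hXX0 hlr₀ hXXg
    hCC hC hl hl' hq hK₁ h3₁ h3₁' hcd hdc hK₂ h3₂ h3₂' hqm (-θ) (nsDivPower_neg_top_eq_pointIntegralHodgeClass_of_principal X eX hθ hd₁)

end Principal

end ComplexTorusCat

end Literature.AlgebraicGeometry.HodgeTheory
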